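import Summits.ResolutionOfSingularities.ResolutionOfSingularities.Theorems.EquisingularLiftEquisingularLiftNatTowerBDoublePrimeSAssembly
import Summits.ResolutionOfSingularities.ResolutionOfSingularities.Theorems.EquisingularLiftEquisingularLiftNatTowerCurveStepBSZero
import Summits.ResolutionOfSingularities.ResolutionOfSingularities.Theorems.EquisingularLiftEquisingularLiftNatInvSZeroStepRegular
import Summits.ResolutionOfSingularities.ResolutionOfSingularities.Theorems.EquisingularLiftEquisingularLiftNatInvSZeroStepSingular
import Summits.ResolutionOfSingularities.ResolutionOfSingularities.Theorems.EquisingularLiftEquisingularLiftNatTCPlusInvBaseSZero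
import HarnessLib

/-!
# [OURS · L1 W4.5(b) · EL♮(3) · T23-A″-S] HSUB‴(ReachTowerB″S)₃ WITH THE SHADOW-FREE ARM INSTANTIATED — `hsub_reachTowerBDoublePrimeS_of_fact_full`
# = V10‴ `hsub_reachTowerBDoublePrimeS_of_fact` (p620031) with `InvS₀ := TCPlus.InvS₀` and its step/curve closure facts := res-type-027's R-b twins; the only
# named inputs left are (T-k) `hFact` and the two char-`p` BASE stand-ins `hBaseKCL` / `hBaseS` (rung-level: `inv_baseKCL` / `inv_baseS`); the shadow-free
# base `inv_baseS₀` is char-free and discharged HERE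

res-L1-w45b-stub-4 g11 (T23-A / A′ / A″ engine owner). OURS; NOT a statement of any manuscript ([Hironaka2017] is a candidate under adjudication, nothing of it is
asserted); AI-written, weaker than expert review. No `sorry`; standard axioms; DEF-FREE. `--supports stmt-ResolutionOfSingularities-20148 --as helper`.
Consumer: res-L1-w45b-stub-2's rung‴ `stub_elnat_defTowerBDoublePrimeSPointResolutionThree` (31st registration, desk DEAL 09:01:29Z).
-/

set_option linter.dupNamespace false -- mandated namespace `Summit.<Summit>.<Problem>` of this single-conjunct summit
set_option linter.overlappingInstances false -- signatures carry `[IsDomain O] [IsDiscreteValuationRing O]`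

noncomputable section

open CategoryTheory CategoryTheory.Limits AlgebraicGeometry TopologicalSpace Topology IsLocalRing
open Literature.AlgebraicGeometry.Resolution
open AlgebraicGeometry.Scheme.IdealSheafData
open Summit.ResolutionOfSingularities.ResolutionOfSingularities.Theses.EquisingularLift.Split
open Summit.ResolutionOfSingularities.ResolutionOfSingularities.Cruxes.EquisingularLift.StrataSplit

namespace Summit.ResolutionOfSingularities.ResolutionOfSingularities.Cruxes.EquisingularLiftNat.Sections

/-- **HSUB‴(ReachTowerB″S)₃, shadow-free arm instantiated** (module docstring). [cite: GortzWedhorn2020, Prop. 13.91 and (13.19)]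
[cite: Liu2002, §8.1 and Thm. 8.1.19] [OURS · L1 W4.5b · T23-A″-S engine] toward `stub_elnat_defTowerBDoublePrimeSPointResolutionThree`; NOT a statement of the
manuscript. -/
theorem hsub_reachTowerBDoublePrimeS_of_fact_full (k : Type) [Field k] [IsAlgClosed k]
    (O : Type) [CommRing O] [IsDomain O] [IsDiscreteValuationRing O] [IsAdicComplete (IsLocalRing.maximalIdeal O) O]
    [IsAlgClosed (IsLocalRing.ResidueField O)] (θ : O →+* k) (hθ : Function.Surjective θ)
    (P : Scheme.{0}) (q : P ⟶ Spec (.of O)) (Y : Set P) (Ch : ∀ X' : Scheme.{0}, (X' ⟶ P) → Set X' → Prop)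
    (hChStep : ∀ (X' X'' : Scheme.{0}) (σ' : X' ⟶ P) (S' : Set X') (C : X'.IdealSheafData) (τ : X'' ⟶ X'),
      Ch X' σ' S' → IsBlowup τ C → Scheme.IsRegular C.subscheme → Flat (C.subschemeι ≫ σ' ≫ q) →
      σ' '' (C.support : Set X') ⊆ {y | ¬ IsGenericPoint y Y} → (C.support : Set X') ∩ (σ' ≫ q) ⁻¹' {IsLocalRing.closedPoint O} ⊆ S' →
      Ch X'' (τ ≫ σ') (closure (τ ⁻¹' (S' \ (C.support : Set X')))))
    (hChSplit : ∀ (X' : Scheme.{0}) (σ' : X' ⟶ P) (S' : Set X'), Ch X' σ' S' → Chain P Y X' σ' S')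
    (hYsp : Y ⊆ q ⁻¹' {IsLocalRing.closedPoint O}) (hYirr : IsIrreducible Y) (hYcl : IsClosed Y) (hPint : IsIntegral P)
    (hPnoeth : IsLocallyNoetherian P) (hPreg : Scheme.IsRegular P) (hqprop : IsProper q) (hqsm : SmoothOfRelativeDimension 3 q)
    (X' : Scheme.{0}) (σ' : X' ⟶ P) (S' : Set X') (hCh' : Ch X' σ' S') (hX'int : IsIntegral X') (hX'noeth : IsLocallyNoetherian X')
    (hX'reg : Scheme.IsRegular X') (hX'dom : IsDominant (σ' ≫ q)) (F₁ : Scheme.{0}) (hF₁ : IsIntegral F₁) (j : F₁ ⟶ X')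
    (t : F₁ ⟶ Spec (.of k)) (hsq : IsPullback j t (σ' ≫ q) (Spec.map (CommRingCat.ofHom θ))) (T₁ : Set F₁) (hT₁cl : IsClosed T₁)
    (hT₁irr : IsIrreducible T₁) (hjT₁ : j '' T₁ = S') (x : F₁) (hx : IsClosed ({x} : Set F₁)) (U : X'.Opens)
    (hU : Smooth (U.ι ≫ σ' ≫ q)) (s : Spec (.of O) ⟶ X') (hs : s ≫ σ' ≫ q = 𝟙 _) (hsU : s (IsLocalRing.closedPoint O) ∈ U)
    (hsx : s (IsLocalRing.closedPoint O) = j x)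
    (hdim : ringKrullDim (X'.presheaf.stalk (s (IsLocalRing.closedPoint O))) = ((3 + 1 : ℕ) : WithBot ℕ∞))
    (hxreg : IsRegularLocalRing (F₁.presheaf.stalk x)) (hsoff : ∀ c ∈ (s.ker.support : Set X'), ¬ IsGenericPoint (σ' c) Y)
    (X₁ : Scheme.{0}) (τ₁ : X₁ ⟶ X') (hτ₁ : IsBlowup τ₁ s.ker) (hX₁int : IsIntegral X₁) (hX₁noeth : IsLocallyNoetherian X₁)
    (hX₁reg : Scheme.IsRegular X₁) (hX₁dom : IsDominant ((τ₁ ≫ σ') ≫ q)) (F₂ : Scheme.{0}) (hF₂ : IsIntegral F₂) (υ : F₂ ⟶ F₁)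
    (hυ : IsBlowup υ (vanishingIdeal (⟨{x}, hx⟩ : Closeds F₁))) (j₂ : F₂ ⟶ X₁) (t₂ : F₂ ⟶ Spec (.of k))
    (hsq₂ : IsPullback j₂ t₂ ((τ₁ ≫ σ') ≫ q) (Spec.map (CommRingCat.ofHom θ))) (hcomm : j₂ ≫ τ₁ = υ ≫ j)
    (hcarrier : (s.ker.comap τ₁).comap j₂ = (vanishingIdeal (⟨{x}, hx⟩ : Closeds F₁)).comap υ)
    (hirr₂ : IsIrreducible (closure (υ ⁻¹' (T₁ \ {x})))) (hCh₁ : Ch X₁ (τ₁ ≫ σ') (j₂ '' closure (υ ⁻¹' (T₁ \ {x}))))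
    -- ===================== THE FACT AND THE NAMED STAND-INS =====================
    -- (T-k) the embedded-curve lift at every stage / exceptional surface over `q` (res-L1-w45b-lead-2 …NatTowerRoundFourDefs p594791)
    (hFact : EmbeddedCurveLift O k θ P q)
    -- (S7′) B9 at the `ConeForm` seed with the LOCALIZED shadow trace (vii-loc) (res-type-100: `…NatConeFormConstants` → KCL twin → `hBaseKCL`)
    (hBaseKCL : ∀ W : Set F₁, x ∈ W → ¬ (υ ⁻¹' {x} ⊆ closure (υ ⁻¹' (W \ {x}))) →
        (∃ U₁ : F₁.affineOpens, x ∈ (U₁ : F₁.Opens) ∧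
          ((vanishingIdeal (⟨closure W, isClosed_closure⟩ : Closeds F₁)).ideal U₁).IsPrincipal) →
        ConeForm F₁ x W →
        TCPlus.InvKCL O k θ P q Y Ch W F₂ (𝟙 F₂) (closure (υ ⁻¹' (T₁ \ {x}))) (υ ⁻¹' {x} ∩ closure (υ ⁻¹' (W \ {x})))
          (closure (υ ⁻¹' (W \ {x}))) false)
    -- ===================== THE S-BRANCH NAMED INPUTS (res-type-027's A″-S bricks; discharged in the rung by `inv_baseS` / the shadow-free twins) =====================
    -- (S-base, conical `W`) `TCPlus.InvS` at the first point step (res-type-027 `inv_baseS`, p618345)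
    (hBaseS : ∀ W : Set F₁, x ∈ W → ¬ (υ ⁻¹' {x} ⊆ closure (υ ⁻¹' (W \ {x}))) →
        (∃ U₁ : F₁.affineOpens, x ∈ (U₁ : F₁.Opens) ∧
          ((vanishingIdeal (⟨closure W, isClosed_closure⟩ : Closeds F₁)).ideal U₁).IsPrincipal) →
        ConeForm F₁ x W →
        TCPlus.InvS O k θ P q Y Ch W F₂ (𝟙 F₂) (closure (υ ⁻¹' (T₁ \ {x}))) (υ ⁻¹' {x} ∩ closure (υ ⁻¹' (W \ {x})))
          (closure (υ ⁻¹' (W \ {x}))) (υ ⁻¹' {x}) false) :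
    -- ===================== THE CONCLUSION OF HSUB‴(ReachTowerB″S)₃ =====================
    ∀ (F' : Scheme.{0}) (β : F' ⟶ F₂) (T' : Set F'), ReachTowerBDoublePrimeS F₁ F₂ υ x (closure (υ ⁻¹' (T₁ \ {x}))) F' β T' →
      ∃ (X₉ : Scheme.{0}) (σ₉ : X₉ ⟶ P) (S₉ : Set X₉) (j₉ : F' ⟶ X₉) (t₉ : F' ⟶ Spec (.of k)),
        Ch X₉ σ₉ S₉ ∧ IsIntegral X₉ ∧ IsLocallyNoetherian X₉ ∧ Scheme.IsRegular X₉ ∧ IsDominant (σ₉ ≫ q) ∧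
        IsPullback j₉ t₉ (σ₉ ≫ q) (Spec.map (CommRingCat.ofHom θ)) ∧ j₉ '' T' = S₉ ∧ IsClosed T' ∧ IsIrreducible T' ∧ IsIntegral F' := by
  haveI := hPint; haveI := hqprop; haveI := hqsm; haveI := hX'int; haveI := hX'noeth; haveI := hF₁; haveI := hX₁int; haveI := hX₁noeth
  haveI := hF₂
  exact hsub_reachTowerBDoublePrimeS_of_fact k O θ hθ P q Y Ch hChStep hChSplit hYsp hYirr hYcl hPint hPnoeth hPreg hqprop hqsm X' σ' S' hCh' hX'int
    hX'noeth hX'reg hX'dom F₁ hF₁ j t hsq T₁ hT₁cl hT₁irr hjT₁ x hx U hU s hs hsU hsx hdim hxreg hsoff X₁ τ₁ hτ₁ hX₁int hX₁noeth hX₁reg hX₁dom F₂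
    hF₂ υ hυ j₂ t₂ hsq₂ hcomm hcarrier hirr₂ hCh₁ hFact hBaseKCL hBaseS
    (TCPlus.InvS₀ O k θ P q Y Ch) (fun W G β T Z S b h => TCPlus.invS₀_inv O k θ P q Y Ch h)
    (fun W hxW hnot hWpr => inv_baseS₀ k O θ hθ P q Y Ch hChSplit hPnoeth hPreg X' σ' S' hCh' hX'reg F₁ j t hsq T₁ x hx hxreg U hU s hs hsU hsx
      hdim hsoff X₁ τ₁ hτ₁ hX₁reg hX₁dom F₂ υ hυ j₂ t₂ hsq₂ hcomm hcarrier hCh₁ hirr₂ W hxW hnot hWpr)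
    (fun W G₁ G₂ β T Z S b y υ₁ hy hI hyT h1 h2 hbl =>
      invS₀_step_regular O k θ hθ P q Y hYsp hYirr hYcl hPnoeth hPreg Ch hChSplit hChStep W G₁ G₂ β T Z S b y υ₁ hy hI hyT h1 h2 hbl)
    (fun W G₁ G₂ β T Z S y υ₁ hy hI hyT h1 h2 hbl =>
      invS₀_step_singular O k θ hθ P q Y hYsp hYirr hYcl hPnoeth hPreg Ch hChSplit hChStep W G₁ G₂ β T Z S y υ₁ hy hI hyT h1 h2 hbl)
    (fun W F₉ β₉ T₉ Z₉ S₉ b₉ hZ₉ F₁₀ υ' hI hZinf hScl hSd hTS hZT hTZ hbl => by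
      have h := Tower.invB_of_invS₀_curveStep_forget_FE O k θ hθ P q Y hYsp hYirr hYcl hPnoeth hPreg Ch hChSplit hChStep W F₉ β₉ T₉ Z₉ ∅ S₉ b₉
        hZ₉ F₁₀ υ' hI hZinf rfl hScl hSd hTS hZT hTZ hbl
      simpa only [Set.empty_sdiff, Set.preimage_empty, closure_empty] using h)

end Summit.ResolutionOfSingularities.ResolutionOfSingularities.Cruxes.EquisingularLiftNat.Sections

end
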